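/-
Copyright (c) 2026. All rights reserved.
Released under Apache 2.0 license as described in the file LICENSE.
Authors: abc-iut cell, statement-typer seat abc-iut-L4-t14 (wave 2).
-/
import Literature.AnabelianGeometry.AbsoluteAnabelian.AbsTopIII.RemarksArchimedean
import Literature.Analysis.SpecialFunctions.SmoothCircleLift
import HarnessLib

/-!
# [AbsTopIII] Remark 2.7.3: the automorphism group of `S¹` has order two — proof

Proof-only companion of `AbsTopIII/RemarksArchimedean.lean` (S. Mochizuki, *Topics in absolute
anabelian geometry III*, [MochizukiAbsTopIII2015], Rmk 2.7.3 p. 61 of the kurims manuscript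
`paper:url-5493eb38cbb7`: "`S¹ := {z ∈ ℂ^× | |z| = 1} ⊆ ℂ^×` [a topological group whose automorphism
group is of order `2`]").  DISCHARGES the named fact `Rmk_2_7_3.CircleAutOrderTwo`: every continuous
automorphism of the circle group is `z ↦ z` or `z ↦ z⁻¹`.

Proof (the classical covering-space argument, [cite: HatcherAT2002, Prop. 1.30]): for
`f : S¹ ≃ S¹`, the continuous unit-norm function `t ↦ f(e^{it})` lifts through the covering
`ℝ → S¹` (`Literature.Analysis.SpecialFunctions.exists_continuous_lift_of_norm_eq_one`, built on
Mathlib's `Circle.isCoveringMap_exp`) to a continuous `ψ : ℝ → ℝ`; since `f` is a homomorphism,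
`t ↦ ψ(s + t) - ψ(s)` is another lift of the same function, so by uniqueness of lifts up to `2πℤ`
(`lift_sub_lift_eq_const`) `ψ - ψ(0)` is additive, hence linear (`AddMonoidHom.toRealLinearMap`):
`f(e^{it}) = e^{iat}`.  Injectivity of `f` forces `e^{iat} = 1 ⇔ e^{it} = 1`, whence `a ∈ ℤ` and
`a⁻¹ ∈ ℤ`, i.e. `a = ±1`.  No new definitions; nothing here bears on [IUTchIII] Cor. 3.12.
-/

set_option autoImplicit false

noncomputable section

open Complex

namespace Literature.AnabelianGeometry.AbsoluteAnabelian.AbsTopIII.Rmk_2_7_3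

open Literature.Analysis.SpecialFunctions (exists_continuous_lift_of_norm_eq_one
  lift_sub_lift_eq_const)

/-- A continuous automorphism `f` of `S¹` is `e^{it} ↦ e^{iat}` for some real `a` (lift through the
universal cover and linearity of continuous additive maps `ℝ → ℝ`).
[cite: MochizukiAbsTopIII2015, Rmk 2.7.3 p.61] -/
theorem exists_exp_mul_of_continuousMulEquiv (f : Circle ≃ₜ* Circle) :
    ∃ a : ℝ, ∀ t : ℝ, f (Circle.exp t) = Circle.exp (a * t) := by
  set v : ℝ → ℂ := fun t => ((f (Circle.exp t) : Circle) : ℂ) with hv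
  have hvc : Continuous v :=
    continuous_subtype_val.comp (f.continuous_toFun.comp Circle.exp.continuous)
  have hv1 : ∀ t, ‖v t‖ = 1 := fun t => Circle.norm_coe _
  obtain ⟨ψ, hψc, hψ⟩ := exists_continuous_lift_of_norm_eq_one hvc hv1
  -- `f` is a homomorphism, so for each `s` the shifted function is another lift of `v`
  have key : ∀ s t, ψ (s + t) = ψ s + ψ t - ψ 0 := by
    intro s
    have h₁ : ∀ t, v t = exp (((fun t => ψ (s + t) - ψ s) t : ℝ) * I) := by
      intro t
      have hst : v (s + t) = v s * v t := by
        simp only [hv, Circle.exp_add, map_mul, Circle.coe_mul]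
      rw [hψ (s + t), hψ s] at hst
      push_cast
      rw [sub_mul, Complex.exp_sub, eq_div_iff (Complex.exp_ne_zero _), mul_comm]
      exact hst.symm
    obtain ⟨m, hm⟩ := lift_sub_lift_eq_const (by fun_prop) hψc h₁ hψ
    intro t
    have h0 := hm 0
    have ht := hm t
    simp only [add_zero] at h0
    linarith
  -- `ψ - ψ 0` is a continuous additive map `ℝ → ℝ`, hence linear
  let φ : ℝ →+ ℝ :=
    { toFun := fun t => ψ t - ψ 0
      map_zero' := sub_self _
      map_add' := fun s t => by rw [key]; ring }
  have hφc : Continuous φ := hψc.sub continuous_const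
  have hlin : ∀ t, ψ t - ψ 0 = t * (ψ 1 - ψ 0) := by
    intro t
    have h := (φ.toRealLinearMap hφc).map_smul t (1 : ℝ)
    simp only [AddMonoidHom.coe_toRealLinearMap, smul_eq_mul, mul_one] at h
    exact h
  -- `f(1) = 1` pins `ψ 0 ∈ 2πℤ`
  have h0 : ∃ n : ℤ, ψ 0 = n * (2 * Real.pi) := by
    apply Circle.exp_eq_one.mp
    apply Circle.ext
    rw [Circle.coe_exp, ← hψ 0]
    simp [hv]
  obtain ⟨n, hn⟩ := h0
  refine ⟨ψ 1 - ψ 0, fun t => ?_⟩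
  apply Circle.ext
  rw [Circle.coe_exp]
  change v t = _
  rw [hψ t]
  have hψt : ψ t = (ψ 1 - ψ 0) * t + n * (2 * Real.pi) := by rw [← hn]; linarith [hlin t]
  rw [hψt]
  push_cast
  rw [add_mul, Complex.exp_add]
  have h1 : exp ((n : ℂ) * (2 * (Real.pi : ℂ)) * I) = 1 := by
    rw [Complex.exp_eq_one_iff]
    exact ⟨n, by ring⟩
  rw [h1, mul_one]

/-- DISCHARGE of `CircleAutOrderTwo`: every continuous automorphism of the topological group `S¹`
is the identity or inversion, so `Aut(S¹)` has order exactly `2` (with `circleInv_ne_refl`).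
[cite: MochizukiAbsTopIII2015, Rmk 2.7.3 p.61] -/
theorem CircleAutOrderTwo_holds : CircleAutOrderTwo := by
  intro f
  obtain ⟨a, ha⟩ := exists_exp_mul_of_continuousMulEquiv f
  have hker : ∀ t, Circle.exp (a * t) = 1 ↔ Circle.exp t = 1 := by
    intro t
    rw [← ha t]
    constructor
    · intro h
      exact f.injective (by rw [h, map_one])
    · intro h
      rw [h, map_one]
  have h2pi : (2 * Real.pi : ℝ) ≠ 0 := by positivity
  -- `a ∈ ℤ`
  obtain ⟨n, hn⟩ := Circle.exp_eq_one.mp ((hker (2 * Real.pi)).mpr Circle.exp_two_pi)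
  have ha_n : a = n := mul_right_cancel₀ h2pi hn
  -- `a ≠ 0`
  have ha0 : a ≠ 0 := by
    intro h
    apply Circle.exp_pi_ne_one
    apply (hker Real.pi).mp
    rw [h, zero_mul]
    exact Circle.exp_zero
  -- `a⁻¹ ∈ ℤ`
  obtain ⟨m, hm⟩ := Circle.exp_eq_one.mp
    ((hker (2 * Real.pi / a)).mp (by rw [mul_div_cancel₀ _ ha0]; exact Circle.exp_two_pi))
  have hma : (m : ℝ) * a = 1 := by
    apply mul_right_cancel₀ h2pi
    rw [one_mul]
    calc (m : ℝ) * a * (2 * Real.pi) = m * (2 * Real.pi) * a := by ring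
      _ = 2 * Real.pi / a * a := by rw [← hm]
      _ = 2 * Real.pi := div_mul_cancel₀ _ ha0
  have hmn : m * n = 1 := by
    rw [ha_n] at hma
    exact_mod_cast hma
  have hn1 : n = 1 ∨ n = -1 := Int.eq_one_or_neg_one_of_mul_eq_one' hmn |>.elim
    (fun h => Or.inl h.2) (fun h => Or.inr h.2)
  rcases hn1 with h1 | h1
  · left
    apply ContinuousMulEquiv.ext
    intro z
    obtain ⟨t, rfl⟩ := Circle.exp_surjective z
    rw [ha t, ha_n, h1, ContinuousMulEquiv.refl_apply]
    simp
  · right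
    apply ContinuousMulEquiv.ext
    intro z
    obtain ⟨t, rfl⟩ := Circle.exp_surjective z
    rw [ha t, ha_n, h1, circleInv_apply, ← Circle.exp_neg]
    simp

/-- "a topological group whose automorphism group is of order `2`", literally: the type of
continuous group automorphisms of `S¹` has exactly two elements.
[cite: MochizukiAbsTopIII2015, Rmk 2.7.3 p.61] -/
theorem card_circleAut : Nat.card (Circle ≃ₜ* Circle) = 2 := by
  rw [Nat.card_eq_two_iff]
  refine ⟨ContinuousMulEquiv.refl Circle, circleInv, circleInv_ne_refl.symm, ?_⟩
  ext f
  simp only [Set.mem_insert_iff, Set.mem_singleton_iff, Set.mem_univ, iff_true]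
  exact CircleAutOrderTwo_holds f

/-- "`ℝ_{>0}` [≅ `ℝ`], hence has automorphism group given by `ℝ^×`", literally: `a ↦ (x ↦ a·x)` is a
bijection from `ℝ^×` onto the continuous automorphisms of `(ℝ, +)` (a group isomorphism by
`dilation_mul`). [cite: MochizukiAbsTopIII2015, Rmk 2.7.3 p.61] -/
theorem dilation_bijective : Function.Bijective (dilation : ℝˣ → (ℝ ≃ₜ+ ℝ)) := by
  refine ⟨dilation_injective, fun f => ?_⟩
  obtain ⟨a, ha, -⟩ := RealAutIsDilation_holds f
  exact ⟨a, ha.symm⟩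

/-- **Rmk 2.7.3**, "the topological group `ℂ^×` is also a two-dimensional object with one rigid
dimension [`S¹`] and one non-rigid dimension [`ℝ_{>0}`]", literally: the polar decomposition
`z ↦ (z/|z|, |z|)` is an isomorphism of topological groups `ℂ^× ≅ S¹ × ℝ_{>0}` (PROVED; stated as
`Nonempty` so that this companion file introduces no definitions).
[cite: MochizukiAbsTopIII2015, Rmk 2.7.3 p.61] -/
theorem nonempty_unitsEquivCircleProdPosReal :
    Nonempty (ℂˣ ≃ₜ* Circle × Units.posSubgroup ℝ) := by
  have hn : ∀ u : ℂˣ, ‖(u : ℂ)‖ ≠ 0 := fun u => norm_ne_zero_iff.mpr u.ne_zero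
  have hn' : ∀ u : ℂˣ, ((‖(u : ℂ)‖ : ℝ) : ℂ) ≠ 0 := fun u => Complex.ofReal_ne_zero.mpr (hn u)
  have hmem : ∀ u : ℂˣ, (u : ℂ) / ‖(u : ℂ)‖ ∈ Submonoid.unitSphere ℂ := fun u => by
    simp [Submonoid.unitSphere, Complex.norm_real, hn u]
  -- the two components and the inverse, as bare functions
  let ang : ℂˣ → Circle := fun u => ⟨(u : ℂ) / ‖(u : ℂ)‖, hmem u⟩
  let rad : ℂˣ → Units.posSubgroup ℝ := fun u =>
    ⟨Units.mk0 ‖(u : ℂ)‖ (hn u), by rw [Units.mem_posSubgroup, Units.val_mk0]; exact norm_pos_iff.mpr u.ne_zero⟩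
  let back : Circle × Units.posSubgroup ℝ → ℂˣ := fun q =>
    Units.mk0 ((((q.2 : ℝˣ) : ℝ) : ℂ) * (q.1 : ℂ))
      (mul_ne_zero (Complex.ofReal_ne_zero.mpr q.2.1.ne_zero) q.1.coe_ne_zero)
  have hnorm_back : ∀ q : Circle × Units.posSubgroup ℝ,
      ‖((((q.2 : ℝˣ) : ℝ) : ℂ) * (q.1 : ℂ))‖ = ((q.2 : ℝˣ) : ℝ) := fun q => by
    rw [norm_mul, Complex.norm_real, Real.norm_eq_abs, abs_of_pos q.2.2, Circle.norm_coe, mul_one]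
  refine ⟨{ toFun := fun u => (ang u, rad u)
            invFun := back
            left_inv := fun u => ?_
            right_inv := fun q => ?_
            map_mul' := fun u v => ?_
            continuous_toFun := ?_
            continuous_invFun := ?_ }⟩
  · -- back (ang u, rad u) = u
    ext
    simp only [ang, rad, back, Units.val_mk0]
    exact mul_div_cancel₀ _ (hn' u)
  · -- (ang (back q), rad (back q)) = q
    obtain ⟨z, r⟩ := q
    refine Prod.ext ?_ ?_
    · apply Circle.ext
      simp only [ang, back, Units.val_mk0]
      rw [hnorm_back ⟨z, r⟩]
      exact mul_div_cancel_left₀ _ (Complex.ofReal_ne_zero.mpr r.2.ne')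
    · apply Subtype.ext
      ext
      simp only [rad, back, Units.val_mk0]
      exact hnorm_back ⟨z, r⟩
  · -- multiplicativity
    refine Prod.ext ?_ ?_
    · apply Circle.ext
      simp only [ang, Prod.fst_mul, Circle.coe_mul, Units.val_mul, norm_mul]
      push_cast
      rw [mul_div_mul_comm]
    · apply Subtype.ext
      ext
      simp only [rad, Prod.snd_mul, Subgroup.coe_mul, Units.val_mul, Units.val_mk0, norm_mul]
  · -- continuity of the polar map
    refine Continuous.prodMk ?_ ?_
    · exact Continuous.subtype_mk
        (Units.continuous_val.div (Complex.continuous_ofReal.comp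
          (continuous_norm.comp Units.continuous_val)) hn') _
    · refine Continuous.subtype_mk (Units.continuous_iff.mpr ⟨?_, ?_⟩) _
      · exact continuous_norm.comp Units.continuous_val
      · simp only [Units.val_inv_eq_inv_val, Units.val_mk0]
        exact (continuous_norm.comp Units.continuous_val).inv₀ hn
  · -- continuity of the inverse
    have h1 : Continuous fun q : Circle × Units.posSubgroup ℝ =>
        (((q.2 : ℝˣ) : ℝ) : ℂ) * (q.1 : ℂ) :=
      (Complex.continuous_ofReal.comp (Units.continuous_val.comp
        (continuous_subtype_val.comp continuous_snd))).mul (continuous_subtype_val.comp continuous_fst)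
    refine Units.continuous_iff.mpr ⟨h1, ?_⟩
    simp only [back, Units.val_inv_eq_inv_val, Units.val_mk0]
    exact h1.inv₀ fun q => mul_ne_zero (Complex.ofReal_ne_zero.mpr q.2.1.ne_zero) q.1.coe_ne_zero
end Literature.AnabelianGeometry.AbsoluteAnabelian.AbsTopIII.Rmk_2_7_3

end
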